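import Literature.AnabelianGeometry.SemiGraphs.AmbientCategory
import Literature.AnabelianGeometry.SemiGraphs.LocalizationDescent
import Literature.AnabelianGeometry.SemiGraphs.Coverticial

/-!
# Classes of arrows of the ambient category: locally trivial, locally finite étale, finite étale coverings; verticial degrees ([SemiAnbd] Def 2.2, Def 4.2 (i)) — merge step M5, part 1

Mochizuki, *Semi-graphs of anabelioids*, Publ. RIMS **42** (2006), §2 Def 2.2 (i) p.23 (finite étale
coverings `𝒢' → 𝒢`), Def 2.2 (ii) p.24 (locally trivial / locally finite étale morphisms), §4
Def 4.2 (i) p.52 (the verticial degree `deg_v` of a locally finite étale morphism) (kurims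
`paper:url-f33ace170ff4`). [cite: MochizukiSemiAnbd2006, Def 2.2 (ii), p. 24]

CONSTRUCTION for the L3 bridge (cell ruling abc-iut-L3-lead 2026-08-25T20:36Z, step M5): the
predicates of t1's 2-categorical model (`SemiGraphOfAnabelioids.Hom.IsLocallyTrivial`,
`Hom.IsLocallyFiniteEtale`, `Hom.IsFiniteEtaleCoveringGlobal`) on the ARROWS of the Rmk 2.4.2
1-category `SgAQuot` (2-isomorphism classes of 1-morphisms), i.e. the container data
`SemiAnbdVocab.IsLocallyTrivial / IsLocallyFiniteEtale / IsFiniteEtale / vertDegree` at the real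
vocabulary:

* `HomOver.IsLocallyTrivial.of_iso2`, `HomOver.IsLocallyFiniteEtale.of_iso2` — both notions descend to
  2-isomorphism classes (an equivalence / a functor of the form `S^* ⋙ α` stays so under isomorphism
  of functors), whence `SgAQuot.locallyTrivial`, `SgAQuot.locallyFiniteEtale : MorphismProperty SgAQuot`
  with computation rules `homMk_mem_…_iff`;
* `SgAQuot.finiteEtale` — "the arrow is the class of a finite étale covering `𝒢' → 𝒢` in print's
  sense" (`Hom.IsFiniteEtaleCoveringGlobal`, local ∧ global ∧ aligned, rulings κ2/μ2/π2/ρ2);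
* `SgAQuot.Hom.vertDegree F v` — Def 4.2 (i) "the degree of the finite étale morphism `H_v → K_w`
  induced by" `F`: the index `[Π_{K_w} : image of Π_{H_v}]` at the canonical basepoint (well defined
  on classes: 2-isomorphic constituents have conjugate images, `pi1Map_of_iso`);
* the formal laws the §4 container records that need no anabelioid input: identities and the
  natural arrows `𝒢_H → 𝒢` of pull-backs (`𝒢[v] → 𝒢`, `𝒢[b] → 𝒢[e]`, …) are locally trivial;
  finite étale coverings are locally finite étale; the induced `𝒢[v] → ℋ[f v]` of a locally finite
  étale arrow is locally finite étale.

The two laws needing [GeoAn] Def 1.2.2 bookkeeping ("locally trivial ⇒ locally finite étale",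
"composites of locally finite étale arrows") are the companion `AmbientArrowClassesLaws.lean`
(over `Anabelioids/FiniteEtaleComposition.lean`).  Tempered arrows (Def 3.5 (ii)) are NOT here
(t2's `ProfiniteSemiGraph` model; bridge debt recorded in `InterfaceVocab.lean`).
-/

namespace Literature.AnabelianGeometry.SemiGraphs

open CategoryTheory CategoryTheory.PreGaloisCategory Literature.AnabelianGeometry.Anabelioids

universe v₁ u₁ u

namespace SemiGraphOfAnabelioids

variable {𝒢 ℋ 𝒦 : SemiGraphOfAnabelioids.{v₁, u₁, u}} {f : 𝒢.graph ⟶ ℋ.graph}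

/-! ### Descent of "locally trivial" and "locally finite étale" to 2-isomorphism classes -/

/-- "Locally trivial" descends to 2-isomorphism classes of 1-morphisms (an isomorphic functor of an
equivalence is an equivalence). [cite: MochizukiSemiAnbd2006, Def 2.2 (ii), p. 24] -/
theorem HomOver.IsLocallyTrivial.of_iso2 {φ φ' : HomOver 𝒢 ℋ f} (σ : HomOver.Iso2 φ φ')
    (h : φ.toHom.IsLocallyTrivial) : φ'.toHom.IsLocallyTrivial := by
  refine ⟨fun v => ?_, fun e => ?_⟩
  · exact @Functor.isEquivalence_of_iso _ _ _ _ _ _ (σ.isoV v) (h.1 v)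
  · exact @Functor.isEquivalence_of_iso _ _ _ _ _ _ (σ.isoE e (f.edgeMap e) rfl) (h.2 e)

/-- "Locally finite étale" descends to 2-isomorphism classes of 1-morphisms (`S^* ⋙ α` up to
isomorphism of functors). [cite: MochizukiSemiAnbd2006, Def 2.2 (ii), p. 24] -/
theorem HomOver.IsLocallyFiniteEtale.of_iso2 {φ φ' : HomOver 𝒢 ℋ f} (σ : HomOver.Iso2 φ φ')
    (h : φ.toHom.IsLocallyFiniteEtale) : φ'.toHom.IsLocallyFiniteEtale := by
  refine ⟨fun v => ?_, fun e => ?_⟩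
  · obtain ⟨S, α, hα, ⟨i⟩⟩ := h.1 v
    exact ⟨S, α, hα, ⟨(σ.isoV v).symm ≪≫ i⟩⟩
  · obtain ⟨S, α, hα, ⟨i⟩⟩ := h.2 e
    exact ⟨S, α, hα, ⟨(σ.isoE e (f.edgeMap e) rfl).symm ≪≫ i⟩⟩

/-! ### Identities and the natural arrows of pull-backs are locally trivial -/

/-- The identity 1-morphism is locally trivial. [cite: MochizukiSemiAnbd2006, Def 2.2 (ii), p. 24] -/
theorem Hom.id_isLocallyTrivial (𝒢 : SemiGraphOfAnabelioids.{v₁, u₁, u}) :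
    (Hom.id 𝒢).IsLocallyTrivial := by
  refine ⟨fun v => ?_, fun e => ?_⟩
  · change (𝟭 (𝒢.V v)).IsEquivalence
    infer_instance
  · exact 𝒢.idE_isIsomorphism e e rfl

/-- The transported vertex identity `idV` is an isomorphism of anabelioids.
[cite: MochizukiSemiAnbd2006, Rmk 2.4.2, p. 26] -/
theorem idV_isIsomorphism (𝒢 : SemiGraphOfAnabelioids.{v₁, u₁, u}) (v v' : 𝒢.graph.Vertex)
    (h : v = v') : (𝒢.idV v v' h).IsIsomorphism := by
  subst h
  change (𝟭 (𝒢.V v)).IsEquivalence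
  infer_instance

/-- The induced 1-morphism `𝒢_{H'} → 𝒢_H` over a commutative triangle of semi-graphs over `𝔾`
(e.g. `𝒢[b] → 𝒢[v]`, `𝒢[b] → 𝒢[e]`) is locally trivial. [cite: MochizukiSemiAnbd2006, Def 2.2 (ii), p. 24] -/
theorem inducedAlongMap_isLocallyTrivial (𝒢 : SemiGraphOfAnabelioids.{v₁, u₁, u})
    {H H' : SemiGraph.{u}} (ι : H ⟶ 𝒢.graph) (κ : H' ⟶ H) (ι' : H' ⟶ 𝒢.graph) (r : κ ≫ ι = ι') :
    (𝒢.inducedAlongMap ι κ ι' r).toHom.IsLocallyTrivial :=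
  ⟨fun _ => 𝒢.idV_isIsomorphism _ _ _, fun _ => 𝒢.idE_isIsomorphism _ _ _⟩

/-- `𝒢[b] → 𝒢[v]` is locally trivial. [cite: MochizukiSemiAnbd2006, Def 4.1, p. 50] -/
theorem atBranchToAtVertex_isLocallyTrivial (𝒢 : SemiGraphOfAnabelioids.{v₁, u₁, u})
    (b : 𝒢.graph.Branch) (hb : (𝒢.graph.abuts b).isSome) :
    (𝒢.atBranchToAtVertex b hb).IsLocallyTrivial :=
  𝒢.inducedAlongMap_isLocallyTrivial _ _ _ _

/-- `𝒢[b] → 𝒢[e]` is locally trivial. [cite: MochizukiSemiAnbd2006, Def 4.1, p. 50] -/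
theorem atBranchToAtEdge_isLocallyTrivial (𝒢 : SemiGraphOfAnabelioids.{v₁, u₁, u})
    (b : 𝒢.graph.Branch) (hb : (𝒢.graph.abuts b).isSome) :
    (𝒢.atBranchToAtEdge b hb).IsLocallyTrivial :=
  𝒢.inducedAlongMap_isLocallyTrivial _ _ _ _

/-- `𝒢[v] → 𝒢` is locally trivial. [cite: MochizukiSemiAnbd2006, Def 4.1, p. 50] -/
theorem atVertexHom_isLocallyTrivial (𝒢 : SemiGraphOfAnabelioids.{v₁, u₁, u})
    (v : 𝒢.graph.Vertex) : (𝒢.atVertexHom v).IsLocallyTrivial :=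
  𝒢.inducedAlongHom_isLocallyTrivial _

/-- `𝒢[e] → 𝒢` is locally trivial. [cite: MochizukiSemiAnbd2006, Def 4.1, p. 50] -/
theorem atEdgeHom_isLocallyTrivial (𝒢 : SemiGraphOfAnabelioids.{v₁, u₁, u})
    (e : 𝒢.graph.Edge) : (𝒢.atEdgeHom e).IsLocallyTrivial :=
  𝒢.inducedAlongHom_isLocallyTrivial _

/-- `𝒢[b] → 𝒢` is locally trivial. [cite: MochizukiSemiAnbd2006, Def 4.1, p. 50] -/
theorem atBranchHom_isLocallyTrivial (𝒢 : SemiGraphOfAnabelioids.{v₁, u₁, u})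
    (b : 𝒢.graph.Branch) (hb : (𝒢.graph.abuts b).isSome) :
    (𝒢.atBranchHom b hb).IsLocallyTrivial :=
  𝒢.inducedAlongHom_isLocallyTrivial _

/-! ### Finite étale coverings are locally finite étale -/

/-- The finite étale covering attached to an object of `B(𝒢)` is locally finite étale: its
constituents are the component anabelioids `(𝒢_c)_P → 𝒢_c` (Def 2.2 (i) "constituents of a covering
are connected components of pull-backs"). [cite: MochizukiSemiAnbd2006, Def 2.2 (i), p. 23] -/
theorem Hom.IsFiniteEtaleCoveringOf.isLocallyFiniteEtale {𝒢' : SemiGraphOfAnabelioids.{v₁, u₁, u}}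
    {φ : Hom 𝒢' 𝒢} {A : 𝒢.BObj} (h : φ.IsFiniteEtaleCoveringOf A) : φ.IsLocallyFiniteEtale := by
  obtain ⟨-, cV, cE, -, -, hV, hE, -⟩ := h
  refine ⟨fun v' => ?_, fun e' => ?_⟩
  · obtain ⟨α, hα, hiso⟩ := hV v'
    exact ⟨_, α, hα, hiso⟩
  · obtain ⟨α, hα, hiso⟩ := hE e'
    exact ⟨_, α, hα, hiso⟩

/-- Finite étale coverings in print's sense (local ∧ global ∧ aligned) are locally finite étale.
[cite: MochizukiSemiAnbd2006, Def 2.2 (i), p. 23] -/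
theorem Hom.IsFiniteEtaleCoveringGlobal.isLocallyFiniteEtale
    {𝒢' : SemiGraphOfAnabelioids.{v₁, u₁, u}} {φ : Hom 𝒢' 𝒢} (h : φ.IsFiniteEtaleCoveringGlobal) :
    φ.IsLocallyFiniteEtale := by
  obtain ⟨A, hA, -, -, -⟩ := h
  exact hA.isLocallyFiniteEtale

/-! ### Induced morphisms of localizations of locally finite étale arrows -/

/-- Finite étaleness of a vertex component is unchanged by post-composing with a transported vertex
identity. [cite: MochizukiSemiAnbd2006, Def 2.2 (ii), p. 24] -/
theorem isFiniteEtale_comp_idV {A : Type u₁} [Category.{v₁} A] [GaloisCategory A]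
    (v v' : ℋ.graph.Vertex) (h : v = v') (P : Anabelioids.Hom A (ℋ.V v))
    (hP : IsFiniteEtale P.pullback) : IsFiniteEtale (P.comp (ℋ.idV v v' h)).pullback := by
  subst h; exact hP

/-- Finite étaleness of an edge component at ANY presentation of the image edge.
[cite: MochizukiSemiAnbd2006, Def 2.2 (ii), p. 24] -/
theorem isFiniteEtale_φE (φ : HomOver 𝒢 ℋ f) (e : 𝒢.graph.Edge) (e₁ : ℋ.graph.Edge)
    (h₁ : f.edgeMap e = e₁) (h : IsFiniteEtale (φ.φE e (f.edgeMap e) rfl).pullback) :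
    IsFiniteEtale (φ.φE e e₁ h₁).pullback := by
  subst h₁; exact h

variable {H₁ H₂ : SemiGraph.{u}}

/-- The 1-morphism induced over a commutative square of semi-graphs by a locally finite étale `φ` is
locally finite étale (its constituents are those of `φ`). [cite: MochizukiSemiAnbd2006, Def 4.1 (iv), p. 51] -/
theorem HomOver.inducedAlongSquare_isLocallyFiniteEtale (φ : HomOver 𝒢 ℋ f) (ι₁ : H₁ ⟶ 𝒢.graph)
    (ι₂ : H₂ ⟶ ℋ.graph) (κ : H₁ ⟶ H₂) (r : ι₁ ≫ f = κ ≫ ι₂) (hφ : φ.toHom.IsLocallyFiniteEtale) :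
    (φ.inducedAlongSquare ι₁ ι₂ κ r).toHom.IsLocallyFiniteEtale :=
  ⟨fun w => isFiniteEtale_comp_idV _ _ _ _ (hφ.1 (ι₁.vertexMap w)),
    fun e => isFiniteEtale_φE φ _ _ _ (hφ.2 (ι₁.edgeMap e))⟩

/-- **Def 4.1 (iv) / Def 4.2**: `𝒢[v] → ℋ[f v]` is locally finite étale when `φ` is.
[cite: MochizukiSemiAnbd2006, Def 4.1 (iv), p. 51] -/
theorem HomOver.atVertexMap_isLocallyFiniteEtale (φ : HomOver 𝒢 ℋ f)
    (hφ : φ.toHom.IsLocallyFiniteEtale) (v : 𝒢.graph.Vertex) :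
    (φ.atVertexMap v).IsLocallyFiniteEtale :=
  φ.inducedAlongSquare_isLocallyFiniteEtale _ _ _ _ hφ

/-- **Def 4.1 (iv) / Def 4.2**: `𝒢[e] → ℋ[f e]` is locally finite étale when `φ` is.
[cite: MochizukiSemiAnbd2006, Def 4.1 (iv), p. 51] -/
theorem HomOver.atEdgeMap_isLocallyFiniteEtale (φ : HomOver 𝒢 ℋ f)
    (hφ : φ.toHom.IsLocallyFiniteEtale) (e : 𝒢.graph.Edge) :
    (φ.atEdgeMap e).IsLocallyFiniteEtale :=
  φ.inducedAlongSquare_isLocallyFiniteEtale _ _ _ _ hφ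

/-! ### Verticial degrees (Def 4.2 (i)) -/

/-- The *verticial degree* of a 1-morphism `φ : 𝒢 → ℋ` at a vertex `v` (Def 4.2 (i): "the
[necessarily finite] degree of the finite étale morphism of anabelioids `𝒢_v → ℋ_{f v}`"), rendered
group-theoretically as the index of the image of `Π_{𝒢_v} → Π_{ℋ_{f v}}` for the canonical
basepoint of `𝒢_v` (for a finite étale `(ℋ_w)_S ⥲ 𝒢_v → ℋ_w` with `S` connected this is the degree of
`S`; `0` encodes infinite index — junk for arrows that are not locally finite étale).
[cite: MochizukiSemiAnbd2006, Def 4.2 (i), p. 52] -/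
noncomputable def HomOver.vertDegree (φ : HomOver 𝒢 ℋ f) (v : 𝒢.graph.Vertex) : ℕ :=
  (pi1Map (φ.φV v).pullback (GaloisCategory.getFiberFunctor (𝒢.V v))).range.index

/-- The verticial degree descends to 2-isomorphism classes: 2-isomorphic vertex components have
conjugate images of `π₁` (`pi1Map_of_iso`), hence the same index.
[cite: MochizukiSemiAnbd2006, Def 4.2 (i), p. 52] -/
theorem HomOver.vertDegree_congr {φ φ' : HomOver 𝒢 ℋ f} (σ : HomOver.Iso2 φ φ')
    (v : 𝒢.graph.Vertex) : φ.vertDegree v = φ'.vertDegree v := by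
  unfold HomOver.vertDegree
  set F := GaloisCategory.getFiberFunctor (𝒢.V v)
  have hrange : (pi1Map (φ'.φV v).pullback F).range =
      (pi1Map (φ.φV v).pullback F).range.map
        (Functor.isoWhiskerRight (σ.isoV v) F).conjAut.toMonoidHom := by
    ext τ
    simp only [MonoidHom.mem_range, Subgroup.mem_map, MulEquiv.coe_toMonoidHom]
    constructor
    · rintro ⟨s, rfl⟩
      exact ⟨pi1Map (φ.φV v).pullback F s, ⟨s, rfl⟩, (pi1Map_of_iso (σ.isoV v) F s).symm⟩
    · rintro ⟨_, ⟨s, rfl⟩, rfl⟩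
      exact ⟨s, pi1Map_of_iso (σ.isoV v) F s⟩
  rw [hrange, Subgroup.index_map_of_bijective (MulEquiv.bijective _)]

end SemiGraphOfAnabelioids

/-! ### The classes of arrows of the 1-category -/

namespace SgAQuot

open SemiGraphOfAnabelioids

variable {X Y Z : SgAQuot.{v₁, u₁, u}}

/-- An arrow of the Rmk 2.4.2 category is *locally trivial* if its representatives are (well defined
by `HomOver.IsLocallyTrivial.of_iso2`). [cite: MochizukiSemiAnbd2006, Def 2.2 (ii), p. 24] -/
def locallyTrivial : MorphismProperty SgAQuot.{v₁, u₁, u} := fun X Y a =>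
  Quotient.liftOn a.cls (fun φ : HomOver X.toSgA Y.toSgA a.base => φ.toHom.IsLocallyTrivial)
    (fun _ _ h => by
      obtain ⟨σ⟩ := h
      exact propext ⟨HomOver.IsLocallyTrivial.of_iso2 σ, HomOver.IsLocallyTrivial.of_iso2 σ.symm⟩)

/-- An arrow of the Rmk 2.4.2 category is *locally finite étale* if its representatives are (well
defined by `HomOver.IsLocallyFiniteEtale.of_iso2`). [cite: MochizukiSemiAnbd2006, Def 2.2 (ii), p. 24] -/
def locallyFiniteEtale : MorphismProperty SgAQuot.{v₁, u₁, u} := fun X Y a =>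
  Quotient.liftOn a.cls (fun φ : HomOver X.toSgA Y.toSgA a.base => φ.toHom.IsLocallyFiniteEtale)
    (fun _ _ h => by
      obtain ⟨σ⟩ := h
      exact propext
        ⟨HomOver.IsLocallyFiniteEtale.of_iso2 σ, HomOver.IsLocallyFiniteEtale.of_iso2 σ.symm⟩)

/-- An arrow `X ⟶ Y` of the Rmk 2.4.2 category is a *finite étale covering* of `Y` if it is the class
of a finite étale covering `𝒢' → 𝒢` in print's sense (Def 2.2 (i); `Hom.IsFiniteEtaleCoveringGlobal`:
local description ∧ global `B(𝒢') ≃ B(𝒢)_{/G'}` ∧ branch/vertex alignment).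
[cite: MochizukiSemiAnbd2006, Def 2.2 (i), p. 23] -/
def finiteEtale : MorphismProperty SgAQuot.{v₁, u₁, u} := fun X Y a =>
  ∃ φ : SemiGraphOfAnabelioids.Hom X.toSgA Y.toSgA, homOf φ = a ∧ φ.IsFiniteEtaleCoveringGlobal

/-- The class of `φ` is locally trivial iff `φ` is. [cite: MochizukiSemiAnbd2006, Def 2.2 (ii), p. 24] -/
theorem homMk_mem_locallyTrivial_iff {f : X.toSgA.graph ⟶ Y.toSgA.graph}
    (φ : HomOver X.toSgA Y.toSgA f) : locallyTrivial (homMk φ) ↔ φ.toHom.IsLocallyTrivial :=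
  Iff.rfl

/-- The class of `φ` is locally finite étale iff `φ` is. [cite: MochizukiSemiAnbd2006, Def 2.2 (ii), p. 24] -/
theorem homMk_mem_locallyFiniteEtale_iff {f : X.toSgA.graph ⟶ Y.toSgA.graph}
    (φ : HomOver X.toSgA Y.toSgA f) :
    locallyFiniteEtale (homMk φ) ↔ φ.toHom.IsLocallyFiniteEtale :=
  Iff.rfl

/-- The arrow of a 1-morphism is locally trivial iff the 1-morphism is.
[cite: MochizukiSemiAnbd2006, Def 2.2 (ii), p. 24] -/
theorem homOf_mem_locallyTrivial_iff {𝒢 ℋ : SemiGraphOfAnabelioids.{v₁, u₁, u}}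
    (φ : SemiGraphOfAnabelioids.Hom 𝒢 ℋ) : locallyTrivial (homOf φ) ↔ φ.IsLocallyTrivial :=
  Iff.rfl

/-- The arrow of a 1-morphism is locally finite étale iff the 1-morphism is.
[cite: MochizukiSemiAnbd2006, Def 2.2 (ii), p. 24] -/
theorem homOf_mem_locallyFiniteEtale_iff {𝒢 ℋ : SemiGraphOfAnabelioids.{v₁, u₁, u}}
    (φ : SemiGraphOfAnabelioids.Hom 𝒢 ℋ) :
    locallyFiniteEtale (homOf φ) ↔ φ.IsLocallyFiniteEtale :=
  Iff.rfl

/-- The arrow of a finite étale covering is a finite étale arrow.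
[cite: MochizukiSemiAnbd2006, Def 2.2 (i), p. 23] -/
theorem homOf_mem_finiteEtale {𝒢 ℋ : SemiGraphOfAnabelioids.{v₁, u₁, u}}
    (φ : SemiGraphOfAnabelioids.Hom 𝒢 ℋ) (h : φ.IsFiniteEtaleCoveringGlobal) :
    finiteEtale (homOf φ) :=
  ⟨φ, rfl, h⟩

/-- Identities are locally trivial. [cite: MochizukiSemiAnbd2006, Def 2.2 (ii), p. 24] -/
theorem id_mem_locallyTrivial (X : SgAQuot.{v₁, u₁, u}) : locallyTrivial (𝟙 X) :=
  (homMk_mem_locallyTrivial_iff (HomOver.id X.toSgA)).mpr (Hom.id_isLocallyTrivial X.toSgA)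

/-- **Law `isLocallyFiniteEtale_of_isFiniteEtale`**: finite étale arrows are locally finite étale.
[cite: MochizukiSemiAnbd2006, Def 2.2 (i), p. 23] -/
theorem locallyFiniteEtale_of_finiteEtale {a : X ⟶ Y} (h : finiteEtale a) : locallyFiniteEtale a := by
  obtain ⟨φ, rfl, hφ⟩ := h
  exact (homOf_mem_locallyFiniteEtale_iff φ).mpr hφ.isLocallyFiniteEtale

/-- **Law `isLocallyTrivial_ιV`**: `X[v] → X` is locally trivial. [cite: MochizukiSemiAnbd2006, Def 4.1, p. 50] -/
theorem homOf_atVertexHom_mem_locallyTrivial (𝒢 : SemiGraphOfAnabelioids.{v₁, u₁, u})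
    (v : 𝒢.graph.Vertex) : locallyTrivial (homOf (𝒢.atVertexHom v)) :=
  𝒢.atVertexHom_isLocallyTrivial v

/-- **Law `isLocallyTrivial_ιE`**: `X[e] → X` is locally trivial. [cite: MochizukiSemiAnbd2006, Def 4.1, p. 50] -/
theorem homOf_atEdgeHom_mem_locallyTrivial (𝒢 : SemiGraphOfAnabelioids.{v₁, u₁, u})
    (e : 𝒢.graph.Edge) : locallyTrivial (homOf (𝒢.atEdgeHom e)) :=
  𝒢.atEdgeHom_isLocallyTrivial e

/-- `X[b] → X` is locally trivial. [cite: MochizukiSemiAnbd2006, Def 4.1, p. 50] -/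
theorem homOf_atBranchHom_mem_locallyTrivial (𝒢 : SemiGraphOfAnabelioids.{v₁, u₁, u})
    (b : 𝒢.graph.Branch) (hb : (𝒢.graph.abuts b).isSome) :
    locallyTrivial (homOf (𝒢.atBranchHom b hb)) :=
  𝒢.atBranchHom_isLocallyTrivial b hb

/-- **Law `isLocallyTrivial_βV`**: `X[b] → X[v]` is locally trivial. [cite: MochizukiSemiAnbd2006, Def 4.1, p. 50] -/
theorem homOf_atBranchToAtVertex_mem_locallyTrivial (𝒢 : SemiGraphOfAnabelioids.{v₁, u₁, u})
    (b : 𝒢.graph.Branch) (hb : (𝒢.graph.abuts b).isSome) :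
    locallyTrivial (homOf (𝒢.atBranchToAtVertex b hb)) :=
  𝒢.atBranchToAtVertex_isLocallyTrivial b hb

/-- **Law `isLocallyTrivial_βE`**: `X[b] → X[e]` is locally trivial. [cite: MochizukiSemiAnbd2006, Def 4.1, p. 50] -/
theorem homOf_atBranchToAtEdge_mem_locallyTrivial (𝒢 : SemiGraphOfAnabelioids.{v₁, u₁, u})
    (b : 𝒢.graph.Branch) (hb : (𝒢.graph.abuts b).isSome) :
    locallyTrivial (homOf (𝒢.atBranchToAtEdge b hb)) :=
  𝒢.atBranchToAtEdge_isLocallyTrivial b hb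

/-- **Law `isLocallyFiniteEtale_locMapV`**: the induced `X[v] → Y[F v]` of a locally finite étale arrow
is locally finite étale. [cite: MochizukiSemiAnbd2006, Def 4.1 (iv), p. 51] -/
theorem atVertexMap_mem_locallyFiniteEtale (F : X ⟶ Y) (hF : locallyFiniteEtale F)
    (v : X.toSgA.graph.Vertex) : locallyFiniteEtale (Hom.atVertexMap F v) := by
  obtain ⟨f, a⟩ := F
  induction a using Quotient.ind with
  | _ φ => exact φ.atVertexMap_isLocallyFiniteEtale hF v

/-- **Law `isLocallyFiniteEtale_locMapE`**: the induced `X[e] → Y[F e]` of a locally finite étale arrow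
is locally finite étale. [cite: MochizukiSemiAnbd2006, Def 4.1 (iv), p. 51] -/
theorem atEdgeMap_mem_locallyFiniteEtale (F : X ⟶ Y) (hF : locallyFiniteEtale F)
    (e : X.toSgA.graph.Edge) : locallyFiniteEtale (Hom.atEdgeMap F e) := by
  obtain ⟨f, a⟩ := F
  induction a using Quotient.ind with
  | _ φ => exact φ.atEdgeMap_isLocallyFiniteEtale hF e

/-- **Def 4.2 (i) on arrows of the 1-category**: the verticial degree of `F : X ⟶ Y` at a vertex `v`
of `X` (well defined by `HomOver.vertDegree_congr`). [cite: MochizukiSemiAnbd2006, Def 4.2 (i), p. 52] -/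
noncomputable def Hom.vertDegree (F : X ⟶ Y) (v : X.toSgA.graph.Vertex) : ℕ :=
  Quotient.liftOn F.cls (fun φ : HomOver X.toSgA Y.toSgA F.base => φ.vertDegree v)
    fun _ _ h => by
      obtain ⟨σ⟩ := h
      exact HomOver.vertDegree_congr σ v

/-- Computation rule on classes. [cite: MochizukiSemiAnbd2006, Def 4.2 (i), p. 52] -/
theorem Hom.vertDegree_homMk {f : X.toSgA.graph ⟶ Y.toSgA.graph} (φ : HomOver X.toSgA Y.toSgA f)
    (v : X.toSgA.graph.Vertex) : Hom.vertDegree (homMk φ) v = φ.vertDegree v :=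
  rfl

end SgAQuot

end Literature.AnabelianGeometry.SemiGraphs
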